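import Summits.BirchSwinnertonDyer.BirchSwinnertonDyer.Theorems.ResidualThetaTransportAtTwoResidualSignedLambdaLowerCMAtTwoDeepHalfAwayTwoLevelwise
import Summits.BirchSwinnertonDyer.BirchSwinnertonDyer.Theorems.ResidualThetaTransportAtTwoResidualSignedLambdaLowerCMAtTwoCofreeLimitFamilyFloor
import Summits.BirchSwinnertonDyer.BirchSwinnertonDyer.Theorems.ResidualThetaTransportAtTwoResidualSignedLambdaLowerCMAtTwoCofreeAdmissible
import Summits.BirchSwinnertonDyer.BirchSwinnertonDyer.Theorems.ResidualThetaTransportAtTwoResidualSignedLambdaLowerCMAtTwoLayerPairingOfFunMackeyDual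
import Literature.NumberTheory.GaloisRepresentations.ContinuousShapiroLiftFunctor
import HarnessLib

/-!
# Item 7 (S4₀ `stub_deepHalfAwayTwo`) ASSEMBLED modulo the levelwise orthogonality: `∃ x ∈ 𝐇¹_Γ(T_ρ)`, admissible, with PRESCRIBED
# local classes `loc_w (Sh_n (red_{p^k} proj_n x)) = t n k w` at `S₀` — and the naturality of `loc_w ∘ Sh_n` in `[p]_*` and in Kato's trace

Route `ResidualThetaTransportAtTwo` (RTT), crux RSL_g `ResidualSignedLambdaLowerCMAtTwo` (stmt-BirchSwinnertonDyer-22608); seat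
`prover-bsd-wall-tp2-p2x` g18 (`--supports 22608 --as helper`, closes nothing). THEOREMS ONLY (no definition, no named fact, no instance,
no `sorry`). STUB-PLAN `stub_cmLambdaLower` rev 21.1 §3 item 8 (S4₀): the `S₀`-twin of `DeepHalfAssembly.exists_iwasawaH1_locd₂_eq_strict_of_levelwise_orthogonal`
(p695648). The S₀-side of `x` is PRESCRIBED levelwise by a family of local classes `t n k w ∈ H¹(ℚ_w, Maps(Γ_ℚ ⧸ Γ_n, A_ρ[p^k]))` (`w ∈ S₀`; to
be produced from `χ ∈ P_{S₀}` by the K-d / AwayTwo pins and local Tate duality), COMPATIBLE along `[p]_*` and along the fibre sums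
`Maps(Γ_ℚ ⧸ Γ_{n+1}, ·) → Maps(Γ_ℚ ⧸ Γ_n, ·)` (hypotheses `htpow`, `htsum`: the prescribed condition is stable under `[p]_*` / `Cor`; discharge them with §2/§3 for a concrete `t`).

* §1 `localization_inr_cohomologyMap` (generic discrete `Γ_ℚ`-modules): `loc_w (H¹(f) b) = H¹(f|_w) (loc_w b)` — the equality form of
  `DeepHalfAssembly.localization_inr_cohomologyMap_eq_zero`.
* §2 `localization_shapiroLift_cofreeTorsionPow` — `loc_w (Sh_n ([p]_* c)) = H¹([p]|_w) (loc_w (Sh_n c))` (`shapiroLift_cohomologyMap` + §1);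
  §3 `localization_shapiroLift_layerCores` — `loc_w (Sh_n (cor c)) = H¹(Σ|_w) (loc_w (Sh_{n+1} c))` (`cohomologyMap_coindFinSum_shapiroLift` + §1).
* §4 **`exists_iwasawaH1_prescribed_of_levelwise_orthogonal`**: compact `𝒪`, cyclotomic `κ`, a pinned `I : IwasawaH1DataCoeff`, `S₀ ∌ p` with `ρ`
  unramified off `S₀ ∪ {p}`, a non-degenerate level family `ePk`, a compatible prescribed family `t` from the floor `N₀`, and the levelwise
  orthogonality `hT` of `…DeepHalfAwayTwoLevelwise` (GLUE-7 shape: against the dual classes relaxed at `S₀`, strict at `p` and `∞`) for all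
  `n ≥ N₀`, `k`, all coset representatives ⟹ `∃ x : I.H` with `red_{p^k}(proj_n x)` ADMISSIBLE outside `S₀ ∪ {w ∋ p}` and
  `loc_w (Sh_n (red_{p^k}(proj_n x))) = t n k w` for every `w ∈ S₀`, `n ≥ N₀`, `k`, and EVERY choice of representatives (`shapiroLift_eq_of_reps`).
  Solution sets = admissible ∩ prescribed-at-`S₀`; `hfin` `…CofreeAdmissible`, `hne` p694988, `hSk`/`hSn` `admissible_*` + §2/§3 + `htpow`/`htsum`,
  limit `ThetaTransport.exists_iwasawaH1_of_levelwise_from` (p687735).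

HONEST FRAMING: `--supports` theorems, CONDITIONAL on `hT`, `htpow`, `htsum`; the production of `t` from `χ` and the transfer
`a • χ = locd_S x` are the pins' (K-d / AwayTwo); nothing about any count; BSD is not proved by any of this; RSL_g (22608) and the K3 crux
(20308) stay OPEN. References: [Kato2004Asterisque] §12.2 (p. 220), §13.8 (p. 228); [Rubin2000] App. B Prop. B.2.3, §B.3; [MilneADT2006] I Thm. 4.10 (b);
[NeukirchSchmidtWingberg2008] I §5 (1.5.3)(iv), I §6 (1.6.4)–(1.6.5); [SerreGaloisCohomology1997] I §2.4.
-/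

set_option autoImplicit false
-- the Theorems namespace of this sub repeats the summit name by design (D-0017 nested layout)
set_option linter.dupNamespace false

noncomputable section

open scoped Classical

namespace Summit.BirchSwinnertonDyer.BirchSwinnertonDyer.Theorems

namespace ThetaTransport.DeepHalfAssemblyAway

open CategoryTheory Field NumberField IsDedekindDomain
  Literature.NumberTheory.EllipticCurves Literature.NumberTheory.EllipticCurves.GreenbergSelmer
  Literature.NumberTheory.GaloisRepresentations Literature.NumberTheory.GaloisRepresentations.DiscreteGaloisModule
  Literature.NumberTheory.GaloisCohomology Literature.NumberTheory.EllipticCurves.Kato2004 ZpExtension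

/-! ## §1 Localisation at a finite place commutes with `H¹` of a morphism -/

section Generic

variable {M M' : Type} [AddCommGroup M] [TopologicalSpace M] [DiscreteTopology M]
  [AddCommGroup M'] [TopologicalSpace M'] [DiscreteTopology M']
  (ρ : DiscreteGaloisModule ℚ M) (ρ' : DiscreteGaloisModule ℚ M')

/-- **`loc_w (H¹(f) b) = H¹(f|_w) (loc_w b)`** for a morphism `f : M' → M` of discrete `Γ_ℚ`-modules and a finite place `w`, where `f|_w` is `f`
viewed as a morphism of the local modules at `w` (same map, action restricted along `Γ_{ℚ_w} → Γ_ℚ`). On cocycles both sides are `[f ∘ g ∘ θ_w]`.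
[cite: SerreGaloisCohomology1997, I §2.4] [cite: NeukirchSchmidtWingberg2008, I §5 (1.5.2)] -/
theorem localization_inr_cohomologyMap (f : ρ'.toTopRep ⟶ ρ.toTopRep) (w : HeightOneSpectrum (𝓞 ℚ)) (b : galoisCohomology ρ' 1) :
    galoisCohomology.localization ρ (Sum.inr w) 1 (cohomologyMap f 1 b) =
      cohomologyMap (TopRep.ofHom ⟨f.hom.toContinuousLinearMap, fun d =>
          f.hom.isIntertwining' (resGalOfEmb (closureEmb (K := ℚ) (w.adicCompletion ℚ)) d)⟩ :
        (ρ'.toLocal (Sum.inr w)).toTopRep ⟶ (ρ.toLocal (Sum.inr w)).toTopRep) 1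
        (galoisCohomology.localization ρ' (Sum.inr w) 1 b) := by
  obtain ⟨g, rfl⟩ := oneCocycleClass_surjective _ b
  rw [cohomologyMap_oneCocycleClass, LayerPairingMackeyDual.localization_eq_map, map_oneCocycleClass,
    LayerPairingMackeyDual.localization_eq_map, map_oneCocycleClass]
  refine Eq.trans ?_ (cohomologyMap_oneCocycleClass _ _).symm
  congr 1

end Generic

/-! ## §2–§3 `loc_w ∘ Sh_n` is natural in `[p]_*` and in Kato's trace -/

section Rho

variable {p : ℕ} [Fact p.Prime] (S : Set (PadicAlgCl p)) {d : ℕ} (ρ : FramedGaloisRep ℚ ↥(padicCoeffIntegers S) d)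
  (κ : ZpExtension ℚ p) (n : ℕ) [Fintype (absoluteGaloisGroup ℚ ⧸ κ.layerSubgroup n)]
  {s : absoluteGaloisGroup ℚ ⧸ κ.layerSubgroup n → absoluteGaloisGroup ℚ}
  (hs : ∀ x : absoluteGaloisGroup ℚ ⧸ κ.layerSubgroup n, (s x : absoluteGaloisGroup ℚ ⧸ κ.layerSubgroup n) = x)
  (hs1 : s ((1 : absoluteGaloisGroup ℚ) : absoluteGaloisGroup ℚ ⧸ κ.layerSubgroup n) = 1)
  (w : HeightOneSpectrum (𝓞 ℚ))

/-- **`loc_w (Sh_n ([p]_* c)) = H¹([p]|_w) (loc_w (Sh_n c))`** (`shapiroLift_cohomologyMap` + §1). [cite: NeukirchSchmidtWingberg2008, I §6 Prop. (1.6.4)]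
[cite: Kato2004Asterisque, §13.8 (p. 228)] -/
theorem localization_shapiroLift_cofreeTorsionPow (k : ℕ)
    (c : H1 (cofreeTorsionGaloisModule S ρ ((p ^ (k + 1) : ℕ) : ℤ)) (κ.layerSubgroup n)) :
    galoisCohomology.localization
        ((cofreeTorsionGaloisModule S ρ ((p ^ k : ℕ) : ℤ)).coind (κ.layerSubgroup n) (κ.isOpen_layerSubgroup n)) (Sum.inr w) 1
        (shapiroLift (cofreeTorsionGaloisModule S ρ ((p ^ k : ℕ) : ℤ)).toTopRep (κ.layerSubgroup n) (κ.isOpen_layerSubgroup n)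
          hs hs1 (cohomologyMap (subgroupRepMap (cofreeTorsionPow S ρ k) (κ.layerSubgroup n)) 1 c)) =
      cohomologyMap (TopRep.ofHom ⟨(coindFinMap (cofreeTorsionPow S ρ k) (κ.layerSubgroup n)).hom.toContinuousLinearMap, fun δ =>
          (coindFinMap (cofreeTorsionPow S ρ k) (κ.layerSubgroup n)).hom.isIntertwining'
            (resGalOfEmb (closureEmb (K := ℚ) (w.adicCompletion ℚ)) δ)⟩ :
        (((cofreeTorsionGaloisModule S ρ ((p ^ (k + 1) : ℕ) : ℤ)).coind (κ.layerSubgroup n) (κ.isOpen_layerSubgroup n)).toLocal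
            (Sum.inr w)).toTopRep ⟶
          (((cofreeTorsionGaloisModule S ρ ((p ^ k : ℕ) : ℤ)).coind (κ.layerSubgroup n) (κ.isOpen_layerSubgroup n)).toLocal
            (Sum.inr w)).toTopRep) 1
        (galoisCohomology.localization
          ((cofreeTorsionGaloisModule S ρ ((p ^ (k + 1) : ℕ) : ℤ)).coind (κ.layerSubgroup n) (κ.isOpen_layerSubgroup n)) (Sum.inr w) 1
          (shapiroLift (cofreeTorsionGaloisModule S ρ ((p ^ (k + 1) : ℕ) : ℤ)).toTopRep (κ.layerSubgroup n) (κ.isOpen_layerSubgroup n)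
            hs hs1 c)) := by
  rw [shapiroLift_cohomologyMap]
  exact localization_inr_cohomologyMap
    ((cofreeTorsionGaloisModule S ρ ((p ^ k : ℕ) : ℤ)).coind (κ.layerSubgroup n) (κ.isOpen_layerSubgroup n))
    ((cofreeTorsionGaloisModule S ρ ((p ^ (k + 1) : ℕ) : ℤ)).coind (κ.layerSubgroup n) (κ.isOpen_layerSubgroup n))
    (coindFinMap (cofreeTorsionPow S ρ k) (κ.layerSubgroup n)) w _

variable [Fintype (absoluteGaloisGroup ℚ ⧸ κ.layerSubgroup (n + 1))]
  {s' : absoluteGaloisGroup ℚ ⧸ κ.layerSubgroup (n + 1) → absoluteGaloisGroup ℚ}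
  (hs' : ∀ x : absoluteGaloisGroup ℚ ⧸ κ.layerSubgroup (n + 1), (s' x : absoluteGaloisGroup ℚ ⧸ κ.layerSubgroup (n + 1)) = x)
  (hs'1 : s' ((1 : absoluteGaloisGroup ℚ) : absoluteGaloisGroup ℚ ⧸ κ.layerSubgroup (n + 1)) = 1)

set_option maxHeartbeats 400000 in
/-- **`loc_w (Sh_n (cor c)) = H¹(Σ|_w) (loc_w (Sh_{n+1} c))`**, `Σ : Maps(Γ_ℚ ⧸ Γ_{n+1}, ·) → Maps(Γ_ℚ ⧸ Γ_n, ·)` the fibre sum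
(`cohomologyMap_coindFinSum_shapiroLift` + §1; any coset representatives at the two levels). [cite: NeukirchSchmidtWingberg2008, I §5 Prop. (1.5.3)(iv)]
[cite: Kato2004Asterisque, §12.2 (p. 220)] -/
theorem localization_shapiroLift_layerCores (N : ℤ) (c : H1 (cofreeTorsionGaloisModule S ρ N) (κ.layerSubgroup (n + 1))) :
    galoisCohomology.localization
        ((cofreeTorsionGaloisModule S ρ N).coind (κ.layerSubgroup n) (κ.isOpen_layerSubgroup n)) (Sum.inr w) 1
        (shapiroLift (cofreeTorsionGaloisModule S ρ N).toTopRep (κ.layerSubgroup n) (κ.isOpen_layerSubgroup n)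
          hs hs1 (layerCores (cofreeTorsionGaloisModule S ρ N) κ n c)) =
      cohomologyMap (TopRep.ofHom ⟨(coindFinSum (cofreeTorsionGaloisModule S ρ N).toTopRep
            (κ.layerSubgroup_antitone (Nat.le_succ n))).hom.toContinuousLinearMap, fun δ =>
          (coindFinSum (cofreeTorsionGaloisModule S ρ N).toTopRep (κ.layerSubgroup_antitone (Nat.le_succ n))).hom.isIntertwining'
            (resGalOfEmb (closureEmb (K := ℚ) (w.adicCompletion ℚ)) δ)⟩ :
        (((cofreeTorsionGaloisModule S ρ N).coind (κ.layerSubgroup (n + 1)) (κ.isOpen_layerSubgroup (n + 1))).toLocal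
            (Sum.inr w)).toTopRep ⟶
          (((cofreeTorsionGaloisModule S ρ N).coind (κ.layerSubgroup n) (κ.isOpen_layerSubgroup n)).toLocal (Sum.inr w)).toTopRep) 1
        (galoisCohomology.localization
          ((cofreeTorsionGaloisModule S ρ N).coind (κ.layerSubgroup (n + 1)) (κ.isOpen_layerSubgroup (n + 1))) (Sum.inr w) 1
          (shapiroLift (cofreeTorsionGaloisModule S ρ N).toTopRep (κ.layerSubgroup (n + 1)) (κ.isOpen_layerSubgroup (n + 1))
            hs' hs'1 c)) := by
  haveI : CompactSpace (absoluteGaloisGroup ℚ) := absoluteGaloisGroup_compactSpace ℚ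
  haveI : (κ.layerSubgroup (n + 1)).FiniteIndex := finiteIndex_of_isOpen_of_compactSpace _ (κ.isOpen_layerSubgroup (n + 1))
  letI : Fintype (κ.layerSubgroup n ⧸ (κ.layerSubgroup (n + 1)).subgroupOf (κ.layerSubgroup n)) := Fintype.ofFinite _
  have hcores : layerCores (cofreeTorsionGaloisModule S ρ N) κ n c =
      coresLe (cofreeTorsionGaloisModule S ρ N).toTopRep (κ.layerSubgroup_antitone (Nat.le_succ n))
        (κ.isOpen_layerSubgroup (n + 1)) c := rfl
  rw [hcores, ← cohomologyMap_coindFinSum_shapiroLift (cofreeTorsionGaloisModule S ρ N).toTopRep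
    (κ.layerSubgroup_antitone (Nat.le_succ n)) (κ.isOpen_layerSubgroup n) (κ.isOpen_layerSubgroup (n + 1)) hs hs1 hs' hs'1 c]
  exact localization_inr_cohomologyMap
    ((cofreeTorsionGaloisModule S ρ N).coind (κ.layerSubgroup n) (κ.isOpen_layerSubgroup n))
    ((cofreeTorsionGaloisModule S ρ N).coind (κ.layerSubgroup (n + 1)) (κ.isOpen_layerSubgroup (n + 1)))
    (coindFinSum (cofreeTorsionGaloisModule S ρ N).toTopRep (κ.layerSubgroup_antitone (Nat.le_succ n))) w _

end Rho


/-! ## §4 ASSEMBLY of item 7 (S4₀) modulo the levelwise orthogonality and the prescribed family's compatibilities -/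

section Assembly

open ThetaTransport.DeepHalfLevelwiseAway

variable {p : ℕ} [Fact p.Prime] (S : Set (PadicAlgCl p)) {d : ℕ} (ρ : FramedGaloisRep ℚ ↥(padicCoeffIntegers S) d)
  (ePk : ∀ k : ℕ, ↥(AddSubgroup.torsionBy (Cofree ρ ↥(padicCoeffField S)) ((p ^ k : ℕ) : ℤ)) →
    ↥(AddSubgroup.torsionBy (Cofree ρ ↥(padicCoeffField S)) ((p ^ k : ℕ) : ℤ)) → AlgebraicClosure ℚ)
  (hμPk : ∀ k a b, ePk k a b ^ (p ^ k) = 1)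
  (hadd₁Pk : ∀ k a₁ a₂ b, ePk k (a₁ + a₂) b = ePk k a₁ b * ePk k a₂ b)
  (hadd₂Pk : ∀ k a b₁ b₂, ePk k a (b₁ + b₂) = ePk k a b₁ * ePk k a b₂)
  (hgalPk : ∀ k (σ : absoluteGaloisGroup ℚ) (a b : ↥(AddSubgroup.torsionBy (Cofree ρ ↥(padicCoeffField S)) ((p ^ k : ℕ) : ℤ))),
    σ • ePk k a b = ePk k (cofreeTorsionGaloisModule S ρ _ σ a) (cofreeTorsionGaloisModule S ρ _ σ b))
  (hnondeg : ∀ k T, (∀ a, ePk k a T = 1) → T = 0)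
  (κ : ZpExtension ℚ p) (hκ : κ.IsCyclotomic)
  (S₀ : Finset (HeightOneSpectrum (𝓞 ℚ))) (hS₀ : ∀ w ∈ S₀, (p : 𝓞 ℚ) ∉ w.asIdeal)
  (hρ : ∀ w : HeightOneSpectrum (𝓞 ℚ), w ∉ S₀ → (p : 𝓞 ℚ) ∉ w.asIdeal → ρ.IsUnramifiedAt w)
  {γ : absoluteGaloisGroup ℚ} (I : IwasawaH1DataCoeff (FramedGaloisRep.toGaloisRep ρ) p κ γ)

include hnondeg hκ hS₀ hρ in
/-- **Item 7 (S4₀) ASSEMBLED modulo the levelwise orthogonality and the prescribed family.** Compact `𝒪`, cyclotomic `κ`, a pinned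
`I : IwasawaH1DataCoeff`, `S₀ ∌ p` outside which (and off `p`) `ρ` is unramified, a level family `ePk` non-degenerate at every level; a
PRESCRIBED family of local classes `t n k w ∈ H¹(ℚ_w, Maps(Γ_ℚ ⧸ Γ_n, A_ρ[p^k]))` (`w ∈ S₀`) from the floor `N₀`, STABLE under `[p]_*` (`htpow`) and under Kato's trace (`htsum`) in the Shapiro-local currency (discharge with §2/§3 once `t` is
concrete), and the levelwise orthogonality `hT` of `…DeepHalfAwayTwoLevelwise` for all
`n ≥ N₀`, all `k` and all coset representatives ⟹ `∃ x ∈ 𝐇¹_Γ(T_ρ)` (`I.H`) whose reductions `red_{p^k}(proj_n x)` (`n ≥ N₀`) are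
ADMISSIBLE outside `S₀ ∪ {w ∋ p}` and satisfy `loc_w (Sh_n (red_{p^k}(proj_n x))) = t n k w` at every `w ∈ S₀`, for EVERY choice of
representatives. CONDITIONAL on `hT`, `htpow`, `htsum`; the S₀-pin transfer to `a • χ = locd_S x` is not made here.
[cite: Kato2004Asterisque, §12.2 (p. 220), §13.8 (p. 228)] [cite: Rubin2000, App. B Prop. B.2.3, §B.3] [cite: MilneADT2006, Ch. I, Thm. 4.10(b)] -/
theorem exists_iwasawaH1_prescribed_of_levelwise_orthogonal [CompactSpace ↥(padicCoeffIntegers S)]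
    [instF : ∀ n : ℕ, Fintype (absoluteGaloisGroup ℚ ⧸ κ.layerSubgroup n)]
    [instFin : ∀ k : ℕ, Finite ↥(AddSubgroup.torsionBy (Cofree ρ ↥(padicCoeffField S)) ((p ^ k : ℕ) : ℤ))] (N₀ : ℕ)
    (t : ∀ (n k : ℕ) (w : HeightOneSpectrum (𝓞 ℚ)), galoisCohomology
      (((cofreeTorsionGaloisModule S ρ ((p ^ k : ℕ) : ℤ)).coind (κ.layerSubgroup n) (κ.isOpen_layerSubgroup n)).toLocal (Sum.inr w)) 1)
    (htpow : ∀ n, N₀ ≤ n → ∀ (k : ℕ)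
      {s : absoluteGaloisGroup ℚ ⧸ κ.layerSubgroup n → absoluteGaloisGroup ℚ}
      (hs : ∀ x : absoluteGaloisGroup ℚ ⧸ κ.layerSubgroup n, (s x : absoluteGaloisGroup ℚ ⧸ κ.layerSubgroup n) = x)
      (hs1 : s ((1 : absoluteGaloisGroup ℚ) : absoluteGaloisGroup ℚ ⧸ κ.layerSubgroup n) = 1)
      (c : H1 (cofreeTorsionGaloisModule S ρ ((p ^ (k + 1) : ℕ) : ℤ)) (κ.layerSubgroup n)),
      (∀ w ∈ S₀, galoisCohomology.localization
          ((cofreeTorsionGaloisModule S ρ ((p ^ (k + 1) : ℕ) : ℤ)).coind (κ.layerSubgroup n) (κ.isOpen_layerSubgroup n)) (Sum.inr w) 1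
          (shapiroLift (cofreeTorsionGaloisModule S ρ ((p ^ (k + 1) : ℕ) : ℤ)).toTopRep (κ.layerSubgroup n) (κ.isOpen_layerSubgroup n)
            hs hs1 c) = t n (k + 1) w) →
      ∀ w ∈ S₀, galoisCohomology.localization
          ((cofreeTorsionGaloisModule S ρ ((p ^ k : ℕ) : ℤ)).coind (κ.layerSubgroup n) (κ.isOpen_layerSubgroup n)) (Sum.inr w) 1
          (shapiroLift (cofreeTorsionGaloisModule S ρ ((p ^ k : ℕ) : ℤ)).toTopRep (κ.layerSubgroup n) (κ.isOpen_layerSubgroup n)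
            hs hs1 (cohomologyMap (subgroupRepMap (cofreeTorsionPow S ρ k) (κ.layerSubgroup n)) 1 c)) = t n k w)
    (htsum : ∀ n, N₀ ≤ n → ∀ (k : ℕ)
      {s : absoluteGaloisGroup ℚ ⧸ κ.layerSubgroup n → absoluteGaloisGroup ℚ}
      (hs : ∀ x : absoluteGaloisGroup ℚ ⧸ κ.layerSubgroup n, (s x : absoluteGaloisGroup ℚ ⧸ κ.layerSubgroup n) = x)
      (hs1 : s ((1 : absoluteGaloisGroup ℚ) : absoluteGaloisGroup ℚ ⧸ κ.layerSubgroup n) = 1)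
      {s' : absoluteGaloisGroup ℚ ⧸ κ.layerSubgroup (n + 1) → absoluteGaloisGroup ℚ}
      (hs' : ∀ x : absoluteGaloisGroup ℚ ⧸ κ.layerSubgroup (n + 1), (s' x : absoluteGaloisGroup ℚ ⧸ κ.layerSubgroup (n + 1)) = x)
      (hs'1 : s' ((1 : absoluteGaloisGroup ℚ) : absoluteGaloisGroup ℚ ⧸ κ.layerSubgroup (n + 1)) = 1)
      (c : H1 (cofreeTorsionGaloisModule S ρ ((p ^ k : ℕ) : ℤ)) (κ.layerSubgroup (n + 1))),
      (∀ w ∈ S₀, galoisCohomology.localization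
          ((cofreeTorsionGaloisModule S ρ ((p ^ k : ℕ) : ℤ)).coind (κ.layerSubgroup (n + 1)) (κ.isOpen_layerSubgroup (n + 1)))
          (Sum.inr w) 1
          (shapiroLift (cofreeTorsionGaloisModule S ρ ((p ^ k : ℕ) : ℤ)).toTopRep (κ.layerSubgroup (n + 1))
            (κ.isOpen_layerSubgroup (n + 1)) hs' hs'1 c) = t (n + 1) k w) →
      ∀ w ∈ S₀, galoisCohomology.localization
          ((cofreeTorsionGaloisModule S ρ ((p ^ k : ℕ) : ℤ)).coind (κ.layerSubgroup n) (κ.isOpen_layerSubgroup n)) (Sum.inr w) 1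
          (shapiroLift (cofreeTorsionGaloisModule S ρ ((p ^ k : ℕ) : ℤ)).toTopRep (κ.layerSubgroup n) (κ.isOpen_layerSubgroup n)
            hs hs1 (layerCores (cofreeTorsionGaloisModule S ρ ((p ^ k : ℕ) : ℤ)) κ n c)) = t n k w)
    (hT : ∀ n, N₀ ≤ n → ∀ (k : ℕ)
      {s : absoluteGaloisGroup ℚ ⧸ κ.layerSubgroup n → absoluteGaloisGroup ℚ}
      (hs : ∀ x : absoluteGaloisGroup ℚ ⧸ κ.layerSubgroup n, (s x : absoluteGaloisGroup ℚ ⧸ κ.layerSubgroup n) = x)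
      (hs1 : s ((1 : absoluteGaloisGroup ℚ) : absoluteGaloisGroup ℚ ⧸ κ.layerSubgroup n) = 1)
      (b : H1 (cofreeTorsionGaloisModule S ρ ((p ^ k : ℕ) : ℤ)) (κ.layerSubgroup n)),
      (∀ w : HeightOneSpectrum (𝓞 ℚ), w ∉ S₀ → (p : 𝓞 ℚ) ∉ w.asIdeal →
        galoisCohomology.localization
            ((cofreeTorsionGaloisModule S ρ ((p ^ k : ℕ) : ℤ)).coind (κ.layerSubgroup n) (κ.isOpen_layerSubgroup n)) (Sum.inr w) 1
            (shapiroLift (cofreeTorsionGaloisModule S ρ ((p ^ k : ℕ) : ℤ)).toTopRep (κ.layerSubgroup n) (κ.isOpen_layerSubgroup n)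
              hs hs1 b) ∈
          unramifiedSubgroup (GaloisRep.toLocal w
            ((cofreeTorsionGaloisModule S ρ ((p ^ k : ℕ) : ℤ)).coind (κ.layerSubgroup n) (κ.isOpen_layerSubgroup n))) 1) →
      (∀ w : InfinitePlace ℚ,
        galoisCohomology.localization
            ((cofreeTorsionGaloisModule S ρ ((p ^ k : ℕ) : ℤ)).coind (κ.layerSubgroup n) (κ.isOpen_layerSubgroup n)) (Sum.inl w) 1
            (shapiroLift (cofreeTorsionGaloisModule S ρ ((p ^ k : ℕ) : ℤ)).toTopRep (κ.layerSubgroup n) (κ.isOpen_layerSubgroup n)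
              hs hs1 b) = 0) →
      (∀ v : HeightOneSpectrum (𝓞 ℚ), (p : 𝓞 ℚ) ∈ v.asIdeal →
        galoisCohomology.localization
            ((cofreeTorsionGaloisModule S ρ ((p ^ k : ℕ) : ℤ)).coind (κ.layerSubgroup n) (κ.isOpen_layerSubgroup n)) (Sum.inr v) 1
            (shapiroLift (cofreeTorsionGaloisModule S ρ ((p ^ k : ℕ) : ℤ)).toTopRep (κ.layerSubgroup n) (κ.isOpen_layerSubgroup n)
              hs hs1 b) = 0) →
      ∑ w ∈ S₀, localTatePairingZMod
          ((cofreeTorsionGaloisModule S ρ ((p ^ k : ℕ) : ℤ)).coind (κ.layerSubgroup n) (κ.isOpen_layerSubgroup n)) (p ^ k) (Sum.inr w)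
          (LocalInvariants.canonical ℚ (p ^ k) (Sum.inr w)) (t n k w)
          (galoisCohomology.localization
            (((cofreeTorsionGaloisModule S ρ ((p ^ k : ℕ) : ℤ)).coind (κ.layerSubgroup n) (κ.isOpen_layerSubgroup n)).tateDual (p ^ k))
            (Sum.inr w) 1
            (cohomologyMap (coindTateDualMor (cofreeTorsionGaloisModule S ρ ((p ^ k : ℕ) : ℤ))
                (cofreeTorsionGaloisModule S ρ ((p ^ k : ℕ) : ℤ)) (κ.layerSubgroup n)
                (pairingHomOfFun (p ^ k) (ePk k) (hμPk k) (hadd₁Pk k) (hadd₂Pk k)) (κ.isOpen_layerSubgroup n)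
                (fun σ a b => (contPairingOfFun (cofreeTorsionGaloisModule S ρ ((p ^ k : ℕ) : ℤ)) (p ^ k) (ePk k) (hμPk k) (hadd₁Pk k)
                  (hadd₂Pk k) (hgalPk k)).toLin_smul σ a b)) 1
              (shapiroLift (cofreeTorsionGaloisModule S ρ ((p ^ k : ℕ) : ℤ)).toTopRep (κ.layerSubgroup n) (κ.isOpen_layerSubgroup n)
                hs hs1 b))) = 0) :
    ∃ x : I.H, ∀ n k, N₀ ≤ n →
      (∀ w : HeightOneSpectrum (𝓞 ℚ), w ∉ ((↑S₀ : Set (HeightOneSpectrum (𝓞 ℚ))) ∪ {u | (p : 𝓞 ℚ) ∈ u.asIdeal}) →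
        ∀ 𝔓 ∈ w.primesAbove,
          resLe (cofreeTorsionGaloisModule S ρ ((p ^ k : ℕ) : ℤ)).toTopRep
            (inf_le_left : κ.layerSubgroup n ⊓ 𝔓.inertia (absoluteGaloisGroup ℚ) ≤ κ.layerSubgroup n) 1
            (reduceH1CofreePkTorsion S ρ k (κ.layerSubgroup n) (I.proj n x) :
              H1 (cofreeTorsionGaloisModule S ρ ((p ^ k : ℕ) : ℤ)) (κ.layerSubgroup n)) = 0) ∧
      ∀ {s : absoluteGaloisGroup ℚ ⧸ κ.layerSubgroup n → absoluteGaloisGroup ℚ}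
        (hs : ∀ x : absoluteGaloisGroup ℚ ⧸ κ.layerSubgroup n, (s x : absoluteGaloisGroup ℚ ⧸ κ.layerSubgroup n) = x)
        (hs1 : s ((1 : absoluteGaloisGroup ℚ) : absoluteGaloisGroup ℚ ⧸ κ.layerSubgroup n) = 1),
        ∀ w ∈ S₀,
          galoisCohomology.localization
              ((cofreeTorsionGaloisModule S ρ ((p ^ k : ℕ) : ℤ)).coind (κ.layerSubgroup n) (κ.isOpen_layerSubgroup n)) (Sum.inr w) 1
              (shapiroLift (cofreeTorsionGaloisModule S ρ ((p ^ k : ℕ) : ℤ)).toTopRep (κ.layerSubgroup n) (κ.isOpen_layerSubgroup n)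
                hs hs1 (reduceH1CofreePkTorsion S ρ k (κ.layerSubgroup n) (I.proj n x) :
                  H1 (cofreeTorsionGaloisModule S ρ ((p ^ k : ℕ) : ℤ)) (κ.layerSubgroup n))) = t n k w := by
  haveI : CompactSpace (absoluteGaloisGroup ℚ) := absoluteGaloisGroup_compactSpace ℚ
  have hreps : ∀ n, ∃ s : absoluteGaloisGroup ℚ ⧸ κ.layerSubgroup n → absoluteGaloisGroup ℚ,
      (∀ x, (s x : absoluteGaloisGroup ℚ ⧸ κ.layerSubgroup n) = x) ∧ s ((1 : absoluteGaloisGroup ℚ) : _) = 1 :=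
    fun n => exists_reps_one _
  choose s hs hs1 using hreps
  have hSfin : ((↑S₀ : Set (HeightOneSpectrum (𝓞 ℚ))) ∪ {u : HeightOneSpectrum (𝓞 ℚ) | (p : 𝓞 ℚ) ∈ u.asIdeal}).Finite := by
    refine Set.Finite.union S₀.finite_toSet ?_
    have hpne : (p : 𝓞 ℚ) ≠ 0 := by exact_mod_cast (Fact.out : p.Prime).ne_zero
    have hne : Ideal.span {(p : 𝓞 ℚ)} ≠ ⊥ := fun h ↦ hpne (Ideal.span_singleton_eq_bot.mp h)
    refine (Ideal.finite_factors hne).subset fun w hw ↦ ?_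
    simp only [Set.mem_setOf_eq] at hw ⊢
    exact Ideal.dvd_iff_le.mpr ((Ideal.span_singleton_le_iff_mem _).mpr hw)
  have hSp : ∀ u : HeightOneSpectrum (𝓞 ℚ), (p : 𝓞 ℚ) ∈ u.asIdeal →
      u ∈ ((↑S₀ : Set (HeightOneSpectrum (𝓞 ℚ))) ∪ {u : HeightOneSpectrum (𝓞 ℚ) | (p : 𝓞 ℚ) ∈ u.asIdeal}) :=
    fun u hu => Set.mem_union_right _ hu
  -- the solution sets: admissible ∩ prescribed-at-`S₀` (Shapiro currency, for the chosen representatives)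
  obtain ⟨x, hx⟩ := ThetaTransport.exists_iwasawaH1_of_levelwise_from S ρ κ hκ I N₀
    (fun n k => {c : H1 (cofreeTorsionGaloisModule S ρ ((p ^ k : ℕ) : ℤ)) (κ.layerSubgroup n) |
      (∀ w : HeightOneSpectrum (𝓞 ℚ), w ∉ ((↑S₀ : Set (HeightOneSpectrum (𝓞 ℚ))) ∪ {u | (p : 𝓞 ℚ) ∈ u.asIdeal}) →
        ∀ 𝔓 ∈ w.primesAbove,
          resLe (cofreeTorsionGaloisModule S ρ ((p ^ k : ℕ) : ℤ)).toTopRep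
            (inf_le_left : κ.layerSubgroup n ⊓ 𝔓.inertia (absoluteGaloisGroup ℚ) ≤ κ.layerSubgroup n) 1 c = 0) ∧
      ∀ w ∈ S₀,
        galoisCohomology.localization
            ((cofreeTorsionGaloisModule S ρ ((p ^ k : ℕ) : ℤ)).coind (κ.layerSubgroup n) (κ.isOpen_layerSubgroup n)) (Sum.inr w) 1
            (shapiroLift (cofreeTorsionGaloisModule S ρ ((p ^ k : ℕ) : ℤ)).toTopRep (κ.layerSubgroup n) (κ.isOpen_layerSubgroup n)
              (hs n) (hs1 n) c) = t n k w})
    (fun n k _ => (admissible_finite_layer S ρ κ k hSfin n).subset fun c hc => hc.1)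
    (fun j hj => by
      obtain ⟨c, hadm, hpres⟩ := exists_admissible_prescribed_of_levelwise_orthogonal S ρ j ePk hμPk hadd₁Pk hadd₂Pk hgalPk
        (hnondeg j) κ S₀ hS₀ hρ j (hs j) (hs1 j) (t j j) (hT j hj j (hs j) (hs1 j))
      exact ⟨c, hadm, hpres⟩)
    (fun n k hn c hc => ⟨admissible_cofreeTorsionPow S ρ k (κ.layerSubgroup n) hc.1, htpow n hn k (hs n) (hs1 n) c hc.2⟩)
    (fun n k hn c hc => ⟨admissible_layerCores S ρ _ κ hSp n hc.1, htsum n hn k (hs n) (hs1 n) (hs (n + 1)) (hs1 (n + 1)) c hc.2⟩)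
  refine ⟨x, fun n k hn => ⟨(hx n k hn).1, fun hs' hs'1 w hw => ?_⟩⟩
  rw [← shapiroLift_eq_of_reps (cofreeTorsionGaloisModule S ρ ((p ^ k : ℕ) : ℤ)).toTopRep (κ.layerSubgroup n)
    (κ.isOpen_layerSubgroup n) (hs n) (hs1 n) hs' hs'1]
  exact (hx n k hn).2 w hw

end Assembly

end ThetaTransport.DeepHalfAssemblyAway

end Summit.BirchSwinnertonDyer.BirchSwinnertonDyer.Theorems

end
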